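import Literature.Barriers.MatrixMultiplication.RectangularBarrierOmegaTwoCW1
import Literature.Barriers.MatrixMultiplication.RectangularBarrierOmegaTwoCW2
import Literature.Barriers.MatrixMultiplication.RectangularBarrierOmegaTwoCW3
import HarnessLib

/-!
# CLLZ Table 1 (`ω̂(2)` via `CW_q`) — `CLLZ2025_omegaTwo_barrier_CW_holds`

Topic `Literature/Barriers/MatrixMultiplication`; DISCHARGE of the named fact
`CLLZ2025_omegaTwo_barrier_CW` of `RectangularBarrier.lean` (Christandl–Le Gall–Lysikov–Zuiddam,
*Barriers for rectangular matrix multiplication*, comput. complexity 34 (2025) = arXiv:2003.03019v2,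
§4.4 Table 1: "Barriers for upper bounds on `ω(2)` via asymptotic `CW_q`-methods for small `q`"): for
every field `K`, every row `(q, b_q)` of `cllz2025OmegaTwoTable` (`q = 2, …, 14`,
`b_q = 3.0626, …, 3.1714` as printed) and every `CW_q`-method bound `ω̂` on `ω(2)`
(`IsTMethodBound K CW_q 2 ω̂`), `b_q ≤ ω̂`.

Proof: the thirteen row theorems `omegaTwo_bigCw_q` (`RectangularBarrierOmegaTwoCW{1,2,3}.lean`,
generated certified numerics instantiating `omegaHat_bigCw_ge_of_costs` of
`RectangularBarrierCwChain.lean` — the barrier chain for Strassen's upper support functionals proved in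
the tree, Thm. 3.15 with eq. (5) — with near-optimal rational dual certificates for the printed program
(9)–(11); margins `4·10⁻⁶ … 2·10⁻⁴` over the printed four-decimal values); the inline tensor of the fact
is `bigCwTensor K q` by `rfl`.
-/

noncomputable section

namespace Literature.Barriers.MatrixMultiplication

open Literature.Computability.AlgebraicComplexity

/-- **CLLZ Table 1, PROVED**: the named fact `CLLZ2025_omegaTwo_barrier_CW` of
`RectangularBarrier.lean` holds — every `CW_q`-method upper bound on `ω(2)` is at least the printed
barrier `b_q`, `q = 2, …, 14`, over every field.
[cite: ChristandlLeGallLysikovZuiddam2025, §4.4 (Table 1)] -/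
theorem CLLZ2025_omegaTwo_barrier_CW_holds : CLLZ2025_omegaTwo_barrier_CW := by
  intro K _ q b hmem ω hω
  change IsTMethodBound K (bigCwTensor K q) 2 ω at hω
  simp only [cllz2025OmegaTwoTable, List.mem_cons, Prod.mk.injEq, List.not_mem_nil, or_false] at hmem
  rcases hmem with ⟨rfl, rfl⟩ | ⟨rfl, rfl⟩ | ⟨rfl, rfl⟩ | ⟨rfl, rfl⟩ | ⟨rfl, rfl⟩ | ⟨rfl, rfl⟩ |
    ⟨rfl, rfl⟩ | ⟨rfl, rfl⟩ | ⟨rfl, rfl⟩ | ⟨rfl, rfl⟩ | ⟨rfl, rfl⟩ | ⟨rfl, rfl⟩ | ⟨rfl, rfl⟩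
  · exact omegaTwo_bigCw_2 K hω
  · exact omegaTwo_bigCw_3 K hω
  · exact omegaTwo_bigCw_4 K hω
  · exact omegaTwo_bigCw_5 K hω
  · exact omegaTwo_bigCw_6 K hω
  · exact omegaTwo_bigCw_7 K hω
  · exact omegaTwo_bigCw_8 K hω
  · exact omegaTwo_bigCw_9 K hω
  · exact omegaTwo_bigCw_10 K hω
  · exact omegaTwo_bigCw_11 K hω
  · exact omegaTwo_bigCw_12 K hω
  · exact omegaTwo_bigCw_13 K hω
  · exact omegaTwo_bigCw_14 K hω

/-- Row `q = 2` in the printed form: no `CW_2`-method can show `ω(2) < 3.0626`; in particular it cannot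
reach the lower bound `ω(2) ≥ 3`. [cite: ChristandlLeGallLysikovZuiddam2025, §4.4 (Table 1)] -/
theorem omegaTwo_bigCw_two_gt_three (K : Type) [Field K] {ω : ℝ}
    (hω : IsTMethodBound K (bigCwTensor K 2) 2 ω) : 3 < ω :=
  lt_of_lt_of_le (by norm_num) (omegaTwo_bigCw_2 K hω)

end Literature.Barriers.MatrixMultiplication

end
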